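import Mathlib
import Summits.CriticalPhenomena.CardyFormulaZ2.Theses.CardyFlipRusso
import Literature.Probability.Percolation.SmirnovContinuumLimit
import Literature.Analysis.FunctionSpaces.PoissonMappingHomeomorph
import Literature.Probability.LatticeModels.DelaunayGraph
import Literature.Probability.RandomPlanarGeometry.ChordalCurveFamily

/-!
# Sketch — crux `Target` (stmt-CriticalPhenomena-6431, route CardyFlipRusso), crux-ideate r1, ideator 1

First lemmas of the two crux idea cards filed from this seat, stated over EXISTING declarations:

* card `delaunay-annealed-morera` (annealed Smirnov–Beffara contour argument on the Poisson–Delaunay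
  triangulation + UnionJackMorera for the G_s conjunct): `vorCross`, `VoronoiMorera`,
  `VoronoiEndgame`, `GsCardy`, the kernel-checked glue `target_of_morera`, and the algebraic heart of
  "isotropy kills every non-zero-spin channel", `integral_eq_zero_of_covariant` (PROVED);
* card `voronoi-free-isotropy-upgrade` (exact E(2)-covariance of Poisson–Voronoi for free, scale
  invariance along the thinning semigroup, then the shared abstract upgrade crux
  `CardyRotToConfR2SymmetryUpgrade`): `PoissonRotationInvariant`, `VoronoiCrossingRotationCovariant`,
  `VoronoiLimitExists`.

Nothing here is asserted: crux-level statements are `def … : Prop`; the two `theorem`s are proved.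
-/

noncomputable section

open MeasureTheory Filter Set
open scoped Topology

namespace Summit.CriticalPhenomena.CardyFormulaZ2.Cruxes.Target.Ideator1

open Literature.Analysis.FunctionSpaces
open Literature.Probability.RandomPlanarGeometry
open Literature.Probability.Percolation

/-! ### The annealed Poisson–Voronoi crossing functional (verbatim from `Target`, conjunct (i)) -/

/-- The annealed crossing probability of the conformal rectangle `R` at mesh `δ` for Poisson–Voronoi
percolation with black/white nuclei laws `PB`, `PW` — the function of `δ` inside conjunct (i) of
`Theses.CardyFlipRusso.Target`, copied verbatim. -/
def vorCross (PB PW : Measure (PointConfig ℂ)) (R : ConformalRectangle) (δ : ℝ) : ℝ :=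
  (PB.prod PW).real {c | ∃ x ∈ R.arc 0, ∃ y ∈ R.arc 2, JoinedIn (closure R.carrier ∩
    {z | Metric.infDist (z / (δ : ℂ)) (c.1 : Set ℂ) ≤ Metric.infDist (z / (δ : ℂ)) (c.2 : Set ℂ)}) x y}

/-! ### Card `delaunay-annealed-morera` -/

/-- **VoronoiMorera** (card `delaunay-annealed-morera`, deliverable of its K1+K3): for every conformal
rectangle with a Carleson datum there are two Smirnov separating families (tree structure
`IsSmirnovFamily`: continuous, `[0,1]`-valued, uniformly equicontinuous, every subsequential limit
satisfies the contour relation (36) on equilateral triangles and the boundary values (37))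
sandwiching the ANNEALED Poisson–Voronoi crossing functional `vorCross` — the exact Poisson–Delaunay
analogue of the proved triangular fact `smirnov_exists_separatingFamilies` and of the G_s crux
`Theses.UnionJackBeffara.UnionJackMorera`. The families are the annealed separating probabilities
`E[H^{env}_α]` of inner/outer approximating domains; (36) is where Beffara's defect
`2 Σ_e ψ(e) P_a(e)` must be shown to be `o(1)` (level-one 3-arm expansion + isotropy + non-vacuity). -/
def VoronoiMorera : Prop :=
  ∀ (PB PW : Measure (PointConfig ℂ)),
    IsPoissonPointProcess (volume : Measure ℂ) PB → IsPoissonPointProcess (volume : Measure ℂ) PW →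
    ∀ (R : ConformalRectangle) (a b c d : ℂ) (ψ : ConformalEquiv R.carrier (openTriangle a b c)),
      IsEquilateral a b c → d ∈ openSegment ℝ c a → IsCarlesonMap R a b c d ψ →
      ∃ δ₀ > (0 : ℝ), ∃ gm gp : ℝ → Fin 3 → ℂ → ℝ,
        IsSmirnovFamily R a b c δ₀ gm ∧ IsSmirnovFamily R a b c δ₀ gp ∧
        ∃ (zm zp : ℝ → ℂ) (e : ℝ → ℝ),
          (∀ δ ∈ Set.Ioo 0 δ₀, zm δ ∈ R.carrier ∧ zp δ ∈ R.carrier) ∧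
          Tendsto zm (𝓝[>] 0) (𝓝 (R.pt 3)) ∧ Tendsto zp (𝓝[>] 0) (𝓝 (R.pt 3)) ∧
          Tendsto e (𝓝[>] 0) (𝓝 0) ∧
          ∀ δ ∈ Set.Ioo 0 δ₀,
            gm δ 1 (zm δ) - e δ ≤ vorCross PB PW R δ ∧ vorCross PB PW R δ ≤ gp δ 1 (zp δ) + e δ

/-- **VoronoiEndgame** (support, provable now by the tree's abstract Smirnov endgame — verbatim the
shape of `Theses.UnionJackBeffara.UnionJackEndgame` with `vorCross` for the crossing functional):
Smirnov families sandwiching `vorCross` force Cardy's formula for it. -/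
def VoronoiEndgame : Prop :=
  VoronoiMorera →
    ∀ (PB PW : Measure (PointConfig ℂ)),
      IsPoissonPointProcess (volume : Measure ℂ) PB → IsPoissonPointProcess (volume : Measure ℂ) PW →
      ∀ R : ConformalRectangle, R.HasCrossingLimit (vorCross PB PW R) cardyFunction

/-- **GsCardy** — conjunct (ii) of `Target` verbatim (Cardy for site percolation at 1/2 on the
centred square lattice G_s in this route's embedding). In card `delaunay-annealed-morera` it is reached
through the SHARED crux `Theses.UnionJackBeffara.UnionJackMorera` + `UnionJackEndgame` (their
embedding is the similarity `w ↦ ((1-i)/2) w + i/2` of this one) and a half-mesh lattice-shift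
robustness statement (support). -/
def GsCardy : Prop :=
  (let z : (ℤ × ℤ) ⊕ (ℤ × ℤ) → ℂ := Sum.elim (fun x ↦ (x.1 : ℂ) + (x.2 : ℂ) * Complex.I) (fun f ↦ ((f.1 : ℂ) + 1 / 2) + ((f.2 : ℂ) + 1 / 2) * Complex.I); let G : SimpleGraph ((ℤ × ℤ) ⊕ (ℤ × ℤ)) := SimpleGraph.fromRel (fun a b ↦ a.isLeft = true ∧ ((b.isLeft = true ∧ dist (z a) (z b) = 1) ∨ (b.isRight = true ∧ dist (z a) (z b) < 1))); ∀ R : Literature.Probability.RandomPlanarGeometry.ConformalRectangle, R.HasCrossingLimit (fun δ ↦ (Literature.Probability.Percolation.sitePercolation ((ℤ × ℤ) ⊕ (ℤ × ℤ)) Literature.Probability.Percolation.half).real {ω | ∃ u v, Metric.infDist ((δ : ℂ) * z u) (R.arc 0) ≤ 2 * δ ∧ Metric.infDist ((δ : ℂ) * z v) (R.arc 2) ≤ 2 * δ ∧ ω ∈ Literature.Probability.Percolation.siteConnIn G {y | (δ : ℂ) * z y ∈ R.carrier} u v}) Literature.Probability.RandomPlanarGeometry.cardyFunction)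

/-- Glue of card `delaunay-annealed-morera` (kernel-checked): the two Morera statements decide the crux
`Target` of route CardyFlipRusso BY NAME. -/
theorem target_of_morera (hM : VoronoiMorera) (hE : VoronoiEndgame) (hG : GsCardy) :
    Theses.CardyFlipRusso.Target :=
  ⟨fun PB PW hB hW R => hE hM PB PW hB hW R, hG⟩

/-- **Spin selection** — the algebraic heart of "an isotropic (or `C_n`, `n ≥ 3`) law kills every
channel of non-zero spin": if `T` preserves `μ` and `F ∘ T = u • F` with `u ≠ 1`, then `∫ F dμ = 0`.
Used with `T` = rotation of the Poisson environment about a point by `2π/n` and `u = e^{2πik/n}`,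
`k ≢ 0 mod n` (for the Beltrami coefficient: spin `k = 2`, so any `n ≥ 3` works and `n = 2` does
not). [folklore] -/
theorem integral_eq_zero_of_covariant {Ω : Type*} [MeasurableSpace Ω] {μ : Measure Ω}
    (T : Ω ≃ᵐ Ω) (hT : MeasurePreserving T μ μ) {F : Ω → ℂ} (u : ℂ) (hu : u ≠ 1)
    (hcov : ∀ ω, F (T ω) = u * F ω) : ∫ ω, F ω ∂μ = 0 := by
  have h1 : ∫ ω, F (T ω) ∂μ = ∫ ω, F ω ∂μ := hT.integral_comp T.measurableEmbedding F
  have h2 : ∫ ω, F (T ω) ∂μ = u * ∫ ω, F ω ∂μ := by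
    simp_rw [hcov]
    exact integral_const_mul u F
  have h3 : (1 - u) * ∫ ω, F ω ∂μ = 0 := by
    have := h1.symm.trans h2
    linear_combination this
  rcases mul_eq_zero.mp h3 with h | h
  · exact absurd (sub_eq_zero.mp h).symm hu
  · exact h

/-- The finite (`C_n`) form of spin selection used for the G_s conjunct: a period sum that picks up a
non-trivial `n`-th root of unity under the lattice rotation vanishes. [folklore] -/
theorem sum_eq_zero_of_covariant (u S : ℂ) (hu : u ≠ 1) (hS : S = u * S) : S = 0 := by
  have h : (1 - u) * S = 0 := by linear_combination hS
  rcases mul_eq_zero.mp h with h | h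
  · exact absurd (sub_eq_zero.mp h).symm hu
  · exact h

/-! ### Card `voronoi-free-isotropy-upgrade` -/

/-- **Free isotropy of the environment**: the law of a Poisson point process of Lebesgue intensity on
`ℂ` is invariant under every linear isometry of the plane (Kingman's mapping theorem
`IsPoissonPointProcess.mapHomeomorph'` + Lebesgue invariance of isometries + Rényi uniqueness
`existsUnique_isPoissonPointProcess_holds`; provable now). [folklore] -/
def PoissonRotationInvariant : Prop :=
  ∀ (P : Measure (PointConfig ℂ)), IsPoissonPointProcess (volume : Measure ℂ) P →
    ∀ ρ : ℂ ≃ₗᵢ[ℝ] ℂ, P.map (PointConfig.mapHomeomorph ρ.toHomeomorph) = P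

/-- **VoronoiCrossingRotationCovariant** (first lemma of card `voronoi-free-isotropy-upgrade`,
provable now): the annealed Poisson–Voronoi crossing functional of a conformal rectangle equals that
of its image under any linear isometry of the plane, at EVERY mesh — the Voronoi colouring commutes
with isometries and the pair of Poisson laws is isometry invariant. For bond-`ℤ²` the analogous
statement is the XL crux `CardyRotToConfLoopRotation` (DKKMO 2020); here it is free. [folklore] -/
def VoronoiCrossingRotationCovariant : Prop :=
  ∀ (PB PW : Measure (PointConfig ℂ)),
    IsPoissonPointProcess (volume : Measure ℂ) PB → IsPoissonPointProcess (volume : Measure ℂ) PW →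
    ∀ (R : ConformalRectangle) (ρ : ℂ ≃ₗᵢ[ℝ] ℂ) (δ : ℝ),
      vorCross PB PW (R.map ρ.toHomeomorph) δ = vorCross PB PW R δ

/-- **VoronoiLimitExists** (K1 of card `voronoi-free-isotropy-upgrade`, crux): the annealed
Poisson–Voronoi crossing probability of every conformal rectangle converges as the mesh tends to
zero — equivalently, along the exact thinning semigroup `Poisson(λ) → Poisson(pλ)` the
Margulis–Russo/Mecke drift `λ ∂_λ P_λ[U_{abcd}] = E[D_{bcda}] − E[D_{abcd}]` (difference of the
expected numbers of colour-pivotal but removal-robust black nuclei for the crossing and for its dual)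
is integrable against `dλ/λ`. With free rotation/translation covariance this is the whole of
similarity covariance for the subsequential limits. -/
def VoronoiLimitExists : Prop :=
  ∀ (PB PW : Measure (PointConfig ℂ)),
    IsPoissonPointProcess (volume : Measure ℂ) PB → IsPoissonPointProcess (volume : Measure ℂ) PW →
    ∀ R : ConformalRectangle, ∃ L : ℝ, Tendsto (vorCross PB PW R) (𝓝[>] 0) (𝓝 L)

/-- Sanity: conjunct (i) of `Target` implies `VoronoiLimitExists` (the limit being `F(η)` for any
uniformizing datum; `HasCrossingLimit` quantifies over uniformizing data, which exist by the tree's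
named fact — so this direction is stated, not proved, to keep the sketch inside proved facts). -/
def TargetGivesLimitExists : Prop :=
  Theses.CardyFlipRusso.Target → VoronoiLimitExists

end Summit.CriticalPhenomena.CardyFormulaZ2.Cruxes.Target.Ideator1

end
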